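import Mathlib
import Summits.Ventures.PercRepro2.HCov
import Summits.Ventures.PercRepro2.RootLeafUHalf
import Summits.Ventures.PercRepro2.RootLeafUTheorem
import Summits.Ventures.PercRepro2.RootLeafUPocketGraph
import Summits.Ventures.PercRepro2.RootLeafUPocketShare
import Summits.Ventures.PercRepro2.RootLeafUShareK
import Summits.Ventures.PercRepro2.RootLeafUShareL

/-!
# (G4-u) on the root-only pocket at `b`: (HCOV) for a root pendant at an unmarked vertex `u` when
`{u, a₂}` separates `b` from `{o, c}` (blind cell PercRepro2, p4 g16; S3 (G4-u) item (ac); no definitions)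

The class: the root `a₁` is a leaf at the unmarked vertex `u` (edge `f`), and the mark `b` lies in a
**pocket** `P` — a vertex set with `b ∈ P`, `o, c, u, a₂ ∉ P`, every edge touching `P` having both
endpoints in `P ∪ {a₂, u}` — i.e. the two roots `u, a₂` of the smaller instance `(o, u, a₂, c, b)`
separate `b` from the marks `o, c`.  On `Q = {u ↮ a₂}` the pocket is a dead end for the rest of the
graph and `b`'s cluster membership is decided by the pocket edges alone (RootLeafUPocketGraph), which
are independent of the other edges: the **pocket shares** `N = P(Qinn)`, `ρ_K = P(Kinn)`,
`ρ_L = P(Linn)` of RootLeafUPocketShare satisfy every share identity the coin-class argument uses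
(RootLeafUShareK / RootLeafUShareL, the coin argument with abstract shares), hence

* **`T2_nonneg_pocket`**: `0 ≤ T2` — W1 of (G4-u) on the class, UNCONDITIONALLY, every weight vector;
* **`HCov_root_leaf_u_of_pocket`**: (HCOV) at `(o, a₁, a₂, c, b)` from (HCOV) at `(o, u, a₂, c, b)`.

The coin class «`b` adjacent exactly to `{a₂, u}`» (RootLeafUCoinThm) is the pocket `P = {b}`; the
series corollaries of RootLeafUCoinSeries are pockets `P = {b, x}`; the general pocket holds any number
of unmarked vertices and any edges among `P ∪ {a₂, u}` touching `P` — e.g. `b` adjacent to `a₂`, `u` and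
an unmarked `x` itself adjacent to `a₂`, `u` only.
-/

namespace Summit.Ventures.PercRepro2

open UnionCluster CovForm

namespace RootLeafU

namespace Pocket

variable {V : Type*} {E : Type*} [Fintype E] [DecidableEq E] [Fintype V] [DecidableEq V]
  {R : Type*} [Field R] [LinearOrder R] [IsStrictOrderedRing R]

section Theorem

variable (p : E → R) (ends : E → Sym2 V) (o a₂ c b u : V) (P : Set V)

/-- **W1 on the root-only pocket at `b`**: `0 ≤ T2` whenever `b ∈ P`, `o, c, u, a₂ ∉ P` and every edge
touching `P` has both endpoints in `P ∪ {a₂, u}`. -/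
theorem T2_nonneg_pocket (hp : IsProbVec p)
    (hP : ∀ e y z, ends e = s(y, z) → y ∈ P → z ∈ P ∨ z = a₂ ∨ z = u)
    (hb : b ∈ P) (ho : o ∉ P) (hc : c ∉ P) (hu : u ∉ P) (ha : a₂ ∉ P) :
    0 ≤ T2 p ends o a₂ c b u := by
  classical
  -- the outside and pocket parts of a configuration
  obtain ⟨off, hoff⟩ : ∃ off : Config E → Config E,
      (∀ ω e, e ∈ touches ends P → off ω e = false) ∧ (∀ ω e, e ∉ touches ends P → off ω e = ω e) :=
    ⟨fun ω e => if e ∈ touches ends P then false else ω e,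
      fun ω e he => by simp [he], fun ω e he => by simp [he]⟩
  obtain ⟨inn, hinn⟩ : ∃ inn : Config E → Config E,
      (∀ ω e, e ∈ touches ends P → inn ω e = ω e) ∧ (∀ ω e, e ∉ touches ends P → inn ω e = false) :=
    ⟨fun ω e => if e ∈ touches ends P then ω e else false,
      fun ω e he => by simp [he], fun ω e he => by simp [he]⟩
  -- the stable events
  have sPD := stable_PD hP hoff hinn hu ha hc
  have sT := stable_T hP hoff hinn hu ha hc
  have sTp := stable_Tp hP hoff hinn hu ha hc
  have soK := stable_connEvent hP hoff hinn ha ho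
  have soL := stable_connEvent hP hoff hinn hu ho
  have sQ' : ∀ ω : Config E, ¬ Conn ends (inn ω) u a₂ →
      (ω ∈ avoidAll ends a₂ {u} ↔ off ω ∈ avoidAll ends a₂ {u}) := by
    rw [avoidAll_singleton_eq ends a₂ u]
    exact stable_compl (stable_connEvent hP hoff hinn ha hu)
  have hQ : ∀ ω ∈ avoidAll ends a₂ {u}, ¬ Conn ends ω u a₂ := by
    intro ω hω h
    rw [avoidAll_singleton_eq ends a₂ u] at hω
    exact hω (conn_symm h)
  have hPD := fun ω hω => PD_notConn (c := c) (ends := ends) (u := u) (a₂ := a₂) Set.univ ω ⟨hω, trivial⟩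
  have hT := fun ω hω => T_notConn (c := c) (ends := ends) (u := u) (a₂ := a₂) Set.univ ω ⟨hω, trivial⟩
  have hTp := fun ω hω => Tp_notConn (c := c) (ends := ends) (u := u) (a₂ := a₂) Set.univ ω ⟨hω, trivial⟩
  -- the shares
  have sQ := prob_inter_bK p hP hoff hinn ha hb sQ' hQ
  have s1 := prob_inter_bK p hP hoff hinn ha hb (stable_inter sTp soK) (Tp_notConn (connEvent ends a₂ o))
  have s2 := prob_inter_bK p hP hoff hinn ha hb sTp hTp
  have s3 := prob_inter_bL p hP hoff hinn hu hb (stable_inter sPD soK) (PD_notConn (connEvent ends a₂ o))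
  have s4 := prob_inter_bL p hP hoff hinn hu hb (stable_inter sTp soK) (Tp_notConn (connEvent ends a₂ o))
  have s5 := prob_inter_bL p hP hoff hinn hu hb sPD hPD
  have s6 := prob_inter_bL p hP hoff hinn hu hb sTp hTp
  have s7 := prob_inter_bK p hP hoff hinn ha hb sT hT
  have s8 := prob_inter_bL p hP hoff hinn hu hb sT hT
  have s9 := prob_inter_bK p hP hoff hinn ha hb sPD hPD
  have l1 := prob_inter_bL p hP hoff hinn hu hb (stable_inter sT soL) (T_notConn (connEvent ends u o))
  have l3 := prob_inter_bK p hP hoff hinn ha hb (stable_inter sPD soL) (PD_notConn (connEvent ends u o))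
  have l4 := prob_inter_bK p hP hoff hinn ha hb (stable_inter sT soL) (T_notConn (connEvent ends u o))
  rw [Set.inter_assoc] at s1 s3 s4 l1 l3 l4
  -- `N = 0` kills the masses
  have hN0K : prob p {ω : Config E | ¬ Conn ends (inn ω) u a₂} = 0 →
      prob p (PDEvent ends u a₂ c) + prob p (TEvent ends a₂ u c) = 0 := fun h => by
    rw [prob_eq_zero_of_N p hoff hinn sPD hPD h, prob_eq_zero_of_N p hoff hinn sTp hTp h, add_zero]
  have hN0L : prob p {ω : Config E | ¬ Conn ends (inn ω) u a₂} = 0 →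
      prob p (PDEvent ends u a₂ c) + prob p (TEvent ends u a₂ c) = 0 := fun h => by
    rw [prob_eq_zero_of_N p hoff hinn sPD hPD h, prob_eq_zero_of_N p hoff hinn sT hT h, add_zero]
  have hN : 0 ≤ prob p {ω : Config E | ¬ Conn ends (inn ω) u a₂} := prob_nonneg hp _
  have hρL : 0 ≤ prob p {ω : Config E | ¬ Conn ends (inn ω) u a₂ ∧ Conn ends (inn ω) u b} :=
    prob_nonneg hp _
  exact T2_nonneg_of_halves p ends o a₂ c b u
    (Share.T2oL_nonneg_of_shares p ends o a₂ c b u _ _ _ hp hN hρL sQ s2 s5 s6 s7 s8 s9 l1 l3 l4 hN0L)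
    (Share.T2oK_nonneg_of_shares p ends o a₂ c b u _ _ _ hp hN hρL sQ s1 s2 s3 s4 s5 s6 s7 s8 s9 hN0K)

/-- **(G4-u) on the root-only pocket at `b`**: (HCOV) for a root `a₁` pendant at the unmarked `u` follows
from (HCOV) at the smaller instance `(o, u, a₂, c, b)` whenever `b` lies in a pocket `P` with
`o, c, u, a₂ ∉ P` whose edges all end in `P ∪ {a₂, u}` — for every leaf weight and every weight vector. -/
theorem HCov_root_leaf_u_of_pocket (hp : IsProbVec p) {f : E} {a₁ : V} (hf : ends f = s(a₁, u))
    (hleaf : ∀ e, a₁ ∈ ends e → e = f) (h1u : a₁ ≠ u) (h12 : a₁ ≠ a₂) (h1c : a₁ ≠ c)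
    (h1o : a₁ ≠ o) (h1b : a₁ ≠ b)
    (hP : ∀ e y z, ends e = s(y, z) → y ∈ P → z ∈ P ∨ z = a₂ ∨ z = u)
    (hb : b ∈ P) (ho : o ∉ P) (hc : c ∉ P) (hu : u ∉ P) (ha : a₂ ∉ P)
    (h3 : HCov p ends o u a₂ c b) : HCov p ends o a₁ a₂ c b :=
  HCov_root_leaf_u_of p ends hp hf hleaf h1u h12 h1c h1o h1b
    (T2_nonneg_pocket p ends o a₂ c b u P hp hP hb ho hc hu ha) h3

end Theorem

end Pocket

end RootLeafU

end Summit.Ventures.PercRepro2
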